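import Summits.RiemannHypothesis.RiemannHypothesis.Theorems.SoloInformedGroundStateDipole

/-!
# Finite zero dodging is free in support

Session 4 of the informed soloist (E5-lite, `work/e5lite/`) found that OPTIMISED window-`a` Weil tests see an
isolated off-line pair `½ ± η + iγ₀` as soon as the window passes the scale `a ≍ log(γ₀/2π)`, for every
offset `η`, because they avoid ("dodge") the few on-line ordinates inside their spectral main lobe.  The exact
mechanism is the second-order operator

  `D_τ h := −h″ − τ²·h`,

which keeps the support of `h`, keeps `h` a Weil test, and multiplies the Weil transform by a quadratic
polynomial:

* `weilMellin (D_τ h) s = (−(s − ½)² − τ²) · weilMellin h s`            (`weilMellin_weilDodge`);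
* after the height twist `g = (D_τ h)·e^{−iγ₀t}`, at `½ + u + i(γ₀ + θ)` the factor is `−(u + iθ)² − τ²`
  (`weilMellin_weilDodge_twist`): on the critical line (`u = 0`) it is the REAL number `θ² − τ²`, which
  vanishes at the two heights `γ₀ ± τ` (`weilMellin_weilDodge_twist_critical`, `…_eq_zero`), while at the
  off-line pair (`θ = 0`, `u = ±η`) it is `−(η² + τ²) ≠ 0`: the dipole gain of
  `SoloInformedGroundStateDipole` is multiplied by `(η² + τ²)²`, never killed (`norm_sq_weilMellin_weilDodge_offline`);
* iterating over a list of ordinates multiplies the transform by the product of the factors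
  (`weilMellin_weilDodges`), still inside the original support (`tsupport_weilDodges_subset`);
* plugged into the visibility inequality: `weilGroundEnergy_le_of_oddDipole_weilDodge`.

So any finite set of on-line zeros can be removed from the sampling energy of a height-localised test at no
cost in support and at a computable polynomial cost in the gain — the rigorous half of the "dodging" threshold
(sharpest statement §2e (D6′)).  Pure calculus (two integrations by parts); no input about `ζ`.
-/

open MeasureTheory Complex Set Filter Topology Literature.NumberTheory.LFunctions
open scoped ContDiff

namespace Summit.RiemannHypothesis.RiemannHypothesis.Theorems

/-! ## Integration by parts against an exponential -/

/-- `d/dt e^{ct} = c e^{ct}` along the real line. -/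
theorem hasDerivAt_cexp_const_mul_ofReal (c : ℂ) (t : ℝ) :
    HasDerivAt (fun y : ℝ ↦ cexp (c * y)) (c * cexp (c * t)) t := by
  have h1 : HasDerivAt (fun y : ℝ ↦ c * (y : ℂ)) c t := by
    simpa using ((hasDerivAt_id t).ofReal_comp).const_mul c
  convert h1.cexp using 1
  ring

/-- `∫ h′(t) e^{ct} dt = −c ∫ h(t) e^{ct} dt` for `h ∈ C¹_c(ℝ)`. -/
theorem integral_deriv_mul_cexp {h : ℝ → ℂ} (hh : ContDiff ℝ 1 h) (hc : HasCompactSupport h)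
    (c : ℂ) : ∫ t : ℝ, deriv h t * cexp (c * t) = -(c * ∫ t : ℝ, h t * cexp (c * t)) := by
  have hhc : Continuous h := hh.continuous
  have hh'c : Continuous (deriv h) := hh.continuous_deriv le_rfl
  have hec : Continuous (fun t : ℝ ↦ cexp (c * t)) := by fun_prop
  have hec' : Continuous (fun t : ℝ ↦ c * cexp (c * t)) := by fun_prop
  have hmulInt : ∀ {p q : ℝ → ℂ}, Continuous p → Continuous q → HasCompactSupport q →
      Integrable (p * q) (volume : Measure ℝ) := fun hp hq hqs =>
    (hp.mul hq).integrable_of_hasCompactSupport hqs.mul_left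
  have hibp : ∫ t : ℝ, cexp (c * t) * deriv h t = -∫ t : ℝ, c * cexp (c * t) * h t :=
    integral_mul_deriv_eq_deriv_mul_of_integrable
      (u := fun t : ℝ ↦ cexp (c * t)) (u' := fun t : ℝ ↦ c * cexp (c * t)) (v := h) (v' := deriv h)
      (fun t _ => hasDerivAt_cexp_const_mul_ofReal c t)
      (fun t _ => (hh.differentiable one_ne_zero t).hasDerivAt)
      (hmulInt hec hh'c hc.deriv) (hmulInt hec' hhc hc) (hmulInt hec hhc hc)
  calc ∫ t : ℝ, deriv h t * cexp (c * t) = ∫ t : ℝ, cexp (c * t) * deriv h t := by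
          congr 1 with t; ring
    _ = -∫ t : ℝ, c * cexp (c * t) * h t := hibp
    _ = -(c * ∫ t : ℝ, h t * cexp (c * t)) := by
          rw [← integral_const_mul]
          congr 2 with t; ring

/-- `∫ h″(t) e^{ct} dt = c² ∫ h(t) e^{ct} dt` for `h ∈ C²_c(ℝ)`. -/
theorem integral_deriv_deriv_mul_cexp {h : ℝ → ℂ} (hh : ContDiff ℝ 2 h) (hc : HasCompactSupport h)
    (c : ℂ) : ∫ t : ℝ, deriv (deriv h) t * cexp (c * t) = c ^ 2 * ∫ t : ℝ, h t * cexp (c * t) := by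
  have hh' : ContDiff ℝ (1 + 1) h := by rw [one_add_one_eq_two]; exact hh
  rw [integral_deriv_mul_cexp hh'.deriv' hc.deriv c,
    integral_deriv_mul_cexp (hh'.of_le le_self_add) hc c]
  ring

/-! ## The dodging operator -/

/-- The dodging operator `D_τ h = −h″ − τ²h`. -/
noncomputable def weilDodge (τ : ℂ) (h : ℝ → ℂ) : ℝ → ℂ :=
  fun t ↦ -deriv (deriv h) t - τ ^ 2 * h t

/-- Iterated dodging over a list of ordinates. -/
noncomputable def weilDodges : List ℂ → (ℝ → ℂ) → (ℝ → ℂ)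
  | [], h => h
  | τ :: τs, h => weilDodge τ (weilDodges τs h)

/-- Dodging does not enlarge the (topological) support. -/
theorem tsupport_weilDodge_subset (τ : ℂ) (h : ℝ → ℂ) : tsupport (weilDodge τ h) ⊆ tsupport h := by
  have h1 : Function.support (weilDodge τ h) ⊆ tsupport h := by
    intro t ht
    by_contra hnot
    apply ht
    have h0 : h t = 0 := by
      by_contra h0; exact hnot (subset_tsupport _ h0)
    have hd : deriv (deriv h) t = 0 := by
      by_contra hd
      exact hnot (tsupport_deriv_subset (tsupport_deriv_subset (subset_tsupport _ hd)))
    simp [weilDodge, h0, hd]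
  have h2 : closure (Function.support (weilDodge τ h)) ⊆ tsupport h :=
    (closure_mono h1).trans (isClosed_tsupport h).closure_subset
  exact h2

/-- Dodging preserves compact support. -/
theorem hasCompactSupport_weilDodge {h : ℝ → ℂ} (hc : HasCompactSupport h) (τ : ℂ) :
    HasCompactSupport (weilDodge τ h) :=
  IsCompact.of_isClosed_subset hc (isClosed_tsupport _) (tsupport_weilDodge_subset τ h)

/-- Dodging preserves smoothness. -/
theorem contDiff_weilDodge {h : ℝ → ℂ} (hh : ContDiff ℝ ∞ h) (τ : ℂ) : ContDiff ℝ ∞ (weilDodge τ h) := by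
  have h2 : ContDiff ℝ ∞ (deriv (deriv h)) :=
    (contDiff_infty_iff_deriv.mp (contDiff_infty_iff_deriv.mp hh).2).2
  unfold weilDodge
  exact (h2.neg).sub (contDiff_const.mul hh)

/-- Dodged tests are tests. -/
theorem isWeilTest_weilDodge {h : ℝ → ℂ} (hh : IsWeilTest h) (τ : ℂ) : IsWeilTest (weilDodge τ h) :=
  ⟨contDiff_weilDodge hh.1 τ, hasCompactSupport_weilDodge hh.2 τ⟩

/-- Dodging preserves oddness (so dodged dipoles are dipoles). -/
theorem weilDodge_odd {h : ℝ → ℂ} (hodd : ∀ t, h (-t) = -h t) (τ : ℂ) (t : ℝ) :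
    weilDodge τ h (-t) = -weilDodge τ h t := by
  have e1 : deriv h = fun x ↦ deriv h (-x) := by
    funext x
    have := deriv_comp_neg h x   -- deriv (fun x ↦ h (-x)) x = -deriv h (-x)
    have hfun : (fun x ↦ h (-x)) = fun x ↦ -h x := funext hodd
    rw [hfun, deriv.fun_neg] at this
    -- this : -deriv h x = -deriv h (-x)
    exact neg_injective this
  have e2 : deriv (deriv h) (-t) = -deriv (deriv h) t := by
    have := deriv_comp_neg (deriv h) t  -- deriv (fun x ↦ deriv h (-x)) t = -deriv (deriv h) (-t)
    rw [← e1] at this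
    -- this : deriv (deriv h) t = -deriv (deriv h) (-t)
    rw [this, neg_neg]
  simp only [weilDodge, e2, hodd]
  ring

/-! ## The transform identities -/

/-- **Finite dodging is free in support.** `(D_τ h)^(s) = (−(s−½)² − τ²)·ĥ(s)`. -/
theorem weilMellin_weilDodge {h : ℝ → ℂ} (hh : ContDiff ℝ 2 h) (hc : HasCompactSupport h) (τ s : ℂ) :
    weilMellin (weilDodge τ h) s = (-(s - 1 / 2) ^ 2 - τ ^ 2) * weilMellin h s := by
  unfold weilMellin weilDodge
  have hh' : ContDiff ℝ (1 + 1) h := by rw [one_add_one_eq_two]; exact hh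
  have hd2c : Continuous (deriv (deriv h)) := hh'.deriv'.continuous_deriv le_rfl
  have hec : Continuous (fun t : ℝ ↦ cexp ((s - 1 / 2) * t)) := by fun_prop
  have i1 : Integrable (fun t : ℝ ↦ deriv (deriv h) t * cexp ((s - 1 / 2) * t)) :=
    (hd2c.mul hec).integrable_of_hasCompactSupport hc.deriv.deriv.mul_right
  have i2 : Integrable (fun t : ℝ ↦ h t * cexp ((s - 1 / 2) * t)) :=
    (hh.continuous.mul hec).integrable_of_hasCompactSupport hc.mul_right
  calc ∫ t : ℝ, (-deriv (deriv h) t - τ ^ 2 * h t) * cexp ((s - 1 / 2) * t)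
      = ∫ t : ℝ, (-(deriv (deriv h) t * cexp ((s - 1 / 2) * t))
          - τ ^ 2 * (h t * cexp ((s - 1 / 2) * t))) := by
        congr 1 with t; ring
    _ = -(∫ t : ℝ, deriv (deriv h) t * cexp ((s - 1 / 2) * t))
          - τ ^ 2 * ∫ t : ℝ, h t * cexp ((s - 1 / 2) * t) := by
        have i1n : Integrable (fun t : ℝ ↦ -(deriv (deriv h) t * cexp ((s - 1 / 2) * t))) := i1.neg
        have i2c : Integrable (fun t : ℝ ↦ τ ^ 2 * (h t * cexp ((s - 1 / 2) * t))) := i2.const_mul _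
        rw [integral_sub i1n i2c, integral_neg, integral_const_mul]
    _ = (-(s - 1 / 2) ^ 2 - τ ^ 2) * ∫ t : ℝ, h t * cexp ((s - 1 / 2) * t) := by
        rw [integral_deriv_deriv_mul_cexp hh hc]; ring

/-- Iterated dodging multiplies the transform by the product of the factors. -/
theorem weilMellin_weilDodges {h : ℝ → ℂ} (hh : IsWeilTest h) (τs : List ℂ) (s : ℂ) :
    weilMellin (weilDodges τs h) s
      = (τs.map fun τ ↦ (-(s - 1 / 2) ^ 2 - τ ^ 2)).prod * weilMellin h s := by
  induction τs with
  | nil => simp [weilDodges]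
  | cons τ τs ih =>
      have hW : IsWeilTest (weilDodges τs h) := by
        clear ih
        induction τs with
        | nil => simpa [weilDodges] using hh
        | cons σ σs ih2 => exact isWeilTest_weilDodge ih2 σ
      have hW2 : ContDiff ℝ 2 (weilDodges τs h) := by exact_mod_cast contDiff_infty.mp hW.1 2
      rw [weilDodges, weilMellin_weilDodge hW2 hW.2, ih, List.map_cons,
        List.prod_cons]
      ring

/-- Iterated dodged tests are tests. -/
theorem isWeilTest_weilDodges {h : ℝ → ℂ} (hh : IsWeilTest h) (τs : List ℂ) :
    IsWeilTest (weilDodges τs h) := by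
  induction τs with
  | nil => simpa [weilDodges] using hh
  | cons τ τs ih => exact isWeilTest_weilDodge ih τ

/-- Iterated dodging does not enlarge the support. -/
theorem tsupport_weilDodges_subset (τs : List ℂ) (h : ℝ → ℂ) :
    tsupport (weilDodges τs h) ⊆ tsupport h := by
  induction τs with
  | nil => simp [weilDodges]
  | cons τ τs ih => exact (tsupport_weilDodge_subset τ _).trans ih

/-! ## Reading the factor: zero on the dodged heights, `−(η² + τ²)` at the off-line pair -/

/-- After the height twist: at `½ + u + i(γ₀ + θ)` the dodging factor is `−(u + iθ)² − τ²`. -/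
theorem weilMellin_weilDodge_twist {h : ℝ → ℂ} (hh : ContDiff ℝ 2 h) (hc : HasCompactSupport h)
    (τ : ℂ) (u γ₀ θ : ℝ) :
    weilMellin (fun t ↦ weilDodge τ h t * cexp (-(γ₀ * I) * t)) (1 / 2 + u + ((γ₀ + θ : ℝ) : ℂ) * I)
      = (-((u : ℂ) + θ * I) ^ 2 - τ ^ 2)
        * weilMellin (fun t ↦ h t * cexp (-(γ₀ * I) * t)) (1 / 2 + u + ((γ₀ + θ : ℝ) : ℂ) * I) := by
  rw [weilMellin_mul_cexp, weilMellin_mul_cexp, weilMellin_weilDodge hh hc]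
  congr 1
  push_cast
  ring

/-- On the critical line the factor is the real number `θ² − τ²` … -/
theorem weilMellin_weilDodge_twist_critical {h : ℝ → ℂ} (hh : ContDiff ℝ 2 h)
    (hc : HasCompactSupport h) (τ γ₀ θ : ℝ) :
    weilMellin (fun t ↦ weilDodge τ h t * cexp (-(γ₀ * I) * t)) (1 / 2 + ((γ₀ + θ : ℝ) : ℂ) * I)
      = ((θ ^ 2 - τ ^ 2 : ℝ) : ℂ)
        * weilMellin (fun t ↦ h t * cexp (-(γ₀ * I) * t)) (1 / 2 + ((γ₀ + θ : ℝ) : ℂ) * I) := by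
  have := weilMellin_weilDodge_twist hh hc τ 0 γ₀ θ
  simp only [Complex.ofReal_zero, add_zero, zero_add] at this
  rw [this]
  congr 1
  push_cast
  rw [mul_pow, Complex.I_sq]
  ring

/-- … so the dodged test does not see the two heights `γ₀ ± τ` at all. -/
theorem weilMellin_weilDodge_twist_eq_zero {h : ℝ → ℂ} (hh : ContDiff ℝ 2 h)
    (hc : HasCompactSupport h) (τ γ₀ : ℝ) :
    weilMellin (fun t ↦ weilDodge τ h t * cexp (-(γ₀ * I) * t)) (1 / 2 + ((γ₀ + τ : ℝ) : ℂ) * I) = 0 ∧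
    weilMellin (fun t ↦ weilDodge τ h t * cexp (-(γ₀ * I) * t)) (1 / 2 + ((γ₀ + -τ : ℝ) : ℂ) * I) = 0 := by
  refine ⟨?_, ?_⟩
  · rw [weilMellin_weilDodge_twist_critical hh hc]; simp
  · rw [weilMellin_weilDodge_twist_critical hh hc]; simp

/-- At the off-line pair `½ ± η + iγ₀` the factor is `−(η² + τ²)`: the dipole gain
`|∫ h e^{±ηt}|²` of `SoloInformedGroundStateDipole` is multiplied by `(η² + τ²)²`, never destroyed. -/
theorem norm_sq_weilMellin_weilDodge_offline {h : ℝ → ℂ} (hh : ContDiff ℝ 2 h)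
    (hc : HasCompactSupport h) (τ η γ₀ : ℝ) :
    ‖weilMellin (fun t ↦ weilDodge τ h t * cexp (-(γ₀ * I) * t)) (1 / 2 + η + ((γ₀ + 0 : ℝ) : ℂ) * I)‖ ^ 2
      = (η ^ 2 + τ ^ 2) ^ 2
        * ‖weilMellin (fun t ↦ h t * cexp (-(γ₀ * I) * t)) (1 / 2 + η + ((γ₀ + 0 : ℝ) : ℂ) * I)‖ ^ 2 := by
  rw [weilMellin_weilDodge_twist hh hc, norm_mul, mul_pow]
  congr 1
  have : (-((η : ℂ) + (0 : ℝ) * I) ^ 2 - (τ : ℂ) ^ 2) = ((-(η ^ 2 + τ ^ 2) : ℝ) : ℂ) := by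
    push_cast; ring
  rw [this, Complex.norm_real, Real.norm_eq_abs, sq_abs]
  ring

/-! ## Dodged dipoles in the visibility inequality -/

/-- Weil tests are `C²`. -/
theorem contDiff_two_of_isWeilTest {h : ℝ → ℂ} (hh : IsWeilTest h) : ContDiff ℝ 2 h := by
  exact_mod_cast contDiff_infty.mp hh.1 2

/-- **Visibility inequality for a dodged odd dipole.**  `SoloInformedGroundStateDipole`'s
`weilGroundEnergy_le_of_oddDipole` applied to `D_τ h`: the test still lives on `[−a, a]`, its sampling
energy bound `B` is now taken over a transform that VANISHES at the heights `γ₀ ± τ`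
(`weilMellin_weilDodge_twist_eq_zero`), and the gain of the off-line pair is multiplied by `(η² + τ²)²`. -/
theorem weilGroundEnergy_le_of_oddDipole_weilDodge {h : ℝ → ℂ} (hh : IsWeilTest h)
    (hodd : ∀ t, h (-t) = -h t) {a : ℝ} (hhs : tsupport h ⊆ Icc (-a) a) (τ : ℝ)
    (hpos : 0 < ∫ t, ‖weilDodge τ h t‖ ^ 2) {η γ₀ : ℝ} (hζ : riemannZeta (1 / 2 + η + γ₀ * I) = 0)
    (hη : |η| ≤ 1 / 2) (hγ : γ₀ ≠ 0) {B : ℝ}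
    (hB : ∀ T : ℝ, ∑ᶠ ρ ∈ weilZeroIndex T, (riemannZetaZeroOrder ρ : ℝ) *
      ‖weilMellin (fun t ↦ weilDodge τ h t * cexp (-(γ₀ * I) * t)) ρ‖ ^ 2 ≤ B) :
    weilGroundEnergy a ≤
      (B - 4 * ((riemannZetaZeroOrder (1 / 2 + η + γ₀ * I) : ℝ) *
        ((η ^ 2 + τ ^ 2) ^ 2 * ‖∫ t : ℝ, h t * cexp ((η : ℂ) * t)‖ ^ 2))) /
        ∫ t, ‖weilDodge τ h t‖ ^ 2 := by
  have key := weilGroundEnergy_le_of_oddDipole (isWeilTest_weilDodge hh τ) (weilDodge_odd hodd τ)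
    ((tsupport_weilDodge_subset τ h).trans hhs) hpos hζ hη hγ hB
  have e1 : ∀ f : ℝ → ℂ, ∫ t : ℝ, f t * cexp ((η : ℂ) * t) = weilMellin f (1 / 2 + η) := by
    intro f; unfold weilMellin; congr 1 with t; congr 2; ring
  have e : ‖∫ t : ℝ, weilDodge τ h t * cexp ((η : ℂ) * t)‖ ^ 2 =
      (η ^ 2 + τ ^ 2) ^ 2 * ‖∫ t : ℝ, h t * cexp ((η : ℂ) * t)‖ ^ 2 := by
    rw [e1, e1, weilMellin_weilDodge (contDiff_two_of_isWeilTest hh) hh.2, norm_mul, mul_pow]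
    congr 1
    have : (-((1 : ℂ) / 2 + η - 1 / 2) ^ 2 - (τ : ℂ) ^ 2) = ((-(η ^ 2 + τ ^ 2) : ℝ) : ℂ) := by
      push_cast; ring
    rw [this, Complex.norm_real, Real.norm_eq_abs, sq_abs]
    ring
  rw [e] at key
  exact key

end Summit.RiemannHypothesis.RiemannHypothesis.Theorems
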